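import Literature.Barriers.AnomalousDissipation.IntermittentDissipationThm27Steps
import Literature.Barriers.AnomalousDissipation.IntermittentDissipationThm27Limit
import Literature.Barriers.AnomalousDissipation.IntermittentDissipationHolds
import Literature.Barriers.AnomalousDissipation.IntermittentDissipationCompactness
import Literature.Analysis.FluidPDE.DeRosaIsettTermEstimates
import Literature.Analysis.FluidPDE.PressureBesovRegularity
import Literature.Analysis.FunctionSpaces.TorusSpaceTimeCutoff
import HarnessLib

/-!
# De Rosa–Isett 2024, Theorem 2.13: discharge

Barriers/AnomalousDissipation: discharge file for the named facts
`DeRosaIsett2024_s51_finalBound` (the quantitative bound (fin_est_eps_delt) of De Rosa–Isett,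
*Intermittency and lower dimensional dissipation in incompressible fluids*, ARMA 248 (2024),
Paper No. 11 = arXiv:2212.08176, §5.1), hence `DeRosaIsett2024_thm27` (op. cit. Theorem 2.7, via
the tree's `DeRosaIsett2024_thm27_of_s51` and `DeRosaIsett2024_s51_mollifiedLimit_holds`), hence
`DeRosaIsett2024_thm213` (op. cit. Theorem 2.13, via the tree's
`DeRosaIsett2024_thm213_of_thm27_of_compactness` and `DeRosaIsett2024_s61_compactness_holds`).

The proof of (fin_est_eps_delt) follows the printed §5.1 in the symmetric Duchon–Robert form of the
tree (`Torus.two_mul_energyFlux_add_energyFlux_mollified_eq`): split the test function with the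
cut-off `χ_δ` of Lemma 5.2 (`Torus.exists_spaceTime_cutoff`), `φ = φχ_δ + φ(1-χ_δ)`; the second
part and its mollification pair to zero with `D` for `ε < δ` by the support hypothesis
((split_D), (support_condit); `DeRosaIsettTestSupport`); the first part is estimated term by term
by Hölder in `L^{q/3} × L^{(q/3)'}` on the `4δ`-neighbourhood of `S`, whose measure is
`≲ δ^{d-γ}` ((est_chi)), using the slice bounds of `DeRosaIsettIncrementEstimates`, the space–time
bounds of `DeRosaIsettTermEstimates` and the pressure regularity of `PressureBesovRegularity`
((est_D_first_easy), (eul_Rey_err), (est_II), (est_III)).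

## References

* L. De Rosa, P. Isett, Arch. Ration. Mech. Anal. 248 (2024), Paper No. 11, Thms. 2.7, 2.13,
  Lemma 5.2, §5.1, §6.1. [DeRosaIsett2024]
* J. Duchon, R. Robert, Nonlinearity 13 (2000) 249–255. [DuchonRobert2000]
-/

noncomputable section

open MeasureTheory TopologicalSpace Set Function Filter Metric
open _root_.Topology
open scoped ENNReal NNReal Convolution InnerProductSpace RealInnerProductSpace ContDiff

namespace Literature.Barriers.AnomalousDissipation

open Literature.Analysis.FunctionSpaces Literature.Analysis.FunctionSpaces.Torus
open Literature.Analysis.FluidPDE Literature.Analysis.FluidPDE.Torus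

variable {d : Type*} [Fintype d]

/-! ## Auxiliary lemmas -/

/-- A.e. form of the thin-set pairing lemma: if `‖f‖ ≤ ‖F‖ g` a.e. with a weight `g` a.e. bounded
by `b` on `A` and vanishing off `A`, then `|∫ f| ≤ b ∫_A ‖F‖`. [folklore] -/
theorem abs_integral_le_mul_toReal_setLIntegral_ae {X : Type*} [MeasurableSpace X] {μ : Measure X}
    {E : Type*} [NormedAddCommGroup E] {f : X → ℝ} {F : X → E} {g : X → ℝ}
    (hF : AEStronglyMeasurable F μ) {A : Set X} (hA : MeasurableSet A) {b : ℝ}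
    (hfg : ∀ᵐ z ∂μ, ‖f z‖ ≤ ‖F z‖ * g z) (hgb : ∀ᵐ z ∂μ, z ∈ A → g z ≤ b)
    (hgA : ∀ z, z ∉ A → g z = 0) (hfin : ∫⁻ z in A, ‖F z‖ₑ ∂μ < ⊤) :
    |∫ z, f z ∂μ| ≤ b * (∫⁻ z in A, ‖F z‖ₑ ∂μ).toReal := by
  have hFi : IntegrableOn (fun z => ‖F z‖) A μ :=
    ⟨hF.norm.restrict, by simpa [HasFiniteIntegral, enorm_norm] using hfin⟩
  set bound : X → ℝ := fun z => b * A.indicator (fun z => ‖F z‖) z with hbound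
  have hbi : Integrable bound μ := (hFi.integrable_indicator hA).const_mul b
  have hle : ∀ᵐ z ∂μ, ‖f z‖ ≤ bound z := by
    filter_upwards [hfg, hgb] with z hz hzb
    by_cases hzA : z ∈ A
    · show ‖f z‖ ≤ b * A.indicator (fun z => ‖F z‖) z
      rw [indicator_of_mem hzA]
      calc ‖f z‖ ≤ ‖F z‖ * g z := hz
        _ ≤ ‖F z‖ * b := mul_le_mul_of_nonneg_left (hzb hzA) (norm_nonneg _)
        _ = b * ‖F z‖ := mul_comm _ _
    · show ‖f z‖ ≤ b * A.indicator (fun z => ‖F z‖) z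
      rw [indicator_of_notMem hzA, mul_zero]
      calc ‖f z‖ ≤ ‖F z‖ * g z := hz
        _ = 0 := by rw [hgA z hzA, mul_zero]
  calc |∫ z, f z ∂μ| = ‖∫ z, f z ∂μ‖ := (Real.norm_eq_abs _).symm
    _ ≤ ∫ z, bound z ∂μ := norm_integral_le_of_norm_le hbi hle
    _ = b * (∫⁻ z in A, ‖F z‖ₑ ∂μ).toReal := by
        rw [hbound, integral_const_mul, integral_indicator hA, integral_norm_eq_lintegral_enorm hF.restrict]

/-- If `χ` vanishes on the `δ`-ball (sup metric on `ℝ × T^d`) around `(t, x)`, then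
`∂ₜχ(t,x) = 0`. [folklore] -/
theorem timeDeriv_eq_zero_of_ball {χ : ℝ → UnitAddTorus d → ℝ} {t : ℝ} {x : UnitAddTorus d} {δ : ℝ}
    (hδ : 0 < δ) (h : ∀ z ∈ ball ((t, x) : ℝ × UnitAddTorus d) δ, χ z.1 z.2 = 0) :
    Torus.timeDeriv χ t x = 0 := by
  have hev : (fun s => χ s x) =ᶠ[𝓝 t] fun _ => (0 : ℝ) := by
    filter_upwards [Metric.ball_mem_nhds t hδ] with s hs
    refine h (s, x) ?_
    rw [mem_ball, Prod.dist_eq, dist_self]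
    exact max_lt (mem_ball.1 hs) hδ
  rw [Torus.timeDeriv, hev.deriv_eq, deriv_const]

/-- If `χ` vanishes on the `δ`-ball (sup metric on `ℝ × T^d`) around `(t, x)`, then
`∇ₓχ(t,x) = 0`. [folklore] -/
theorem gradient_eq_zero_of_ball [DecidableEq d] {χ : ℝ → UnitAddTorus d → ℝ} {t : ℝ}
    {x : UnitAddTorus d} {δ : ℝ}
    (hδ : 0 < δ) (h : ∀ z ∈ ball ((t, x) : ℝ × UnitAddTorus d) δ, χ z.1 z.2 = 0) :
    Torus.gradient (χ t) x = 0 := by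
  have hev : liftAt (χ t) x =ᶠ[𝓝 0] fun _ => (0 : ℝ) := by
    filter_upwards [Metric.ball_mem_nhds (0 : EuclideanSpace ℝ d) hδ] with w hw
    rw [liftAt_apply]
    refine h (t, x + proj w) ?_
    rw [mem_ball, Prod.dist_eq, dist_self, dist_eq_norm, add_sub_cancel_left]
    exact max_lt hδ ((norm_proj_le w).trans_lt (mem_ball_zero_iff.1 hw))
  rw [Torus.gradient, _root_.gradient, hev.fderiv_eq, fderiv_const_apply 0, map_zero]

/-- Slice-wise mollification distributes over sums of continuous slices. [folklore] -/
theorem conv_kernel_add {ψ₁ ψ₂ : ℝ → UnitAddTorus d → ℝ} (h1 : ∀ t, Continuous (ψ₁ t))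
    (h2 : ∀ t, Continuous (ψ₂ t)) {k : UnitAddTorus d → ℝ} (hk : Continuous k) (t : ℝ) :
    (fun x => ψ₁ t x + ψ₂ t x) ⋆ k = ψ₁ t ⋆ k + ψ₂ t ⋆ k := by
  have hkc : HasCompactSupport k := HasCompactSupport.of_compactSpace k
  have e : (fun x => ψ₁ t x + ψ₂ t x) = ψ₁ t + ψ₂ t := rfl
  rw [e]
  exact (hkc.convolutionExists_right (ContinuousLinearMap.lsmul ℝ ℝ) (h1 t).locallyIntegrable
    hk).add_distrib (hkc.convolutionExists_right (ContinuousLinearMap.lsmul ℝ ℝ) (h2 t).locallyIntegrable hk)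


/-! ## The discharge of (fin_est_eps_delt) -/

/-- **The term bound**: `|∫ f| ≤ b · ‖F‖_{L^r} μ(A)^{1-1/r}` under the hypotheses of the a.e.
thin-set pairing lemma and `‖F‖_{L^r} ≤ B < ∞`. [folklore] -/
theorem abs_integral_le_of_eLpNorm_le {X : Type*} [MeasurableSpace X] {μ : Measure X}
    {E : Type*} [NormedAddCommGroup E] {f : X → ℝ} {F : X → E} {g : X → ℝ}
    (hF : AEStronglyMeasurable F μ) {A : Set X} (hA : MeasurableSet A) {b : ℝ} (hb : 0 ≤ b)
    (hfg : ∀ᵐ z ∂μ, ‖f z‖ ≤ ‖F z‖ * g z) (hgb : ∀ᵐ z ∂μ, z ∈ A → g z ≤ b)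
    (hgA : ∀ z, z ∉ A → g z = 0) {r : ℝ≥0∞} (hr : 1 ≤ r) {B : ℝ≥0∞} (hB : eLpNorm F r μ ≤ B)
    (hBt : B ≠ ⊤) (hμA : μ A ≠ ⊤) :
    |∫ z, f z ∂μ| ≤ b * (B.toReal * (μ A ^ (1 - 1 / r.toReal)).toReal) := by
  have h1 : ∫⁻ z in A, ‖F z‖ₑ ∂μ ≤ B * μ A ^ (1 - 1 / r.toReal) :=
    (setLIntegral_enorm_le_eLpNorm_mul_rpow hF hr A).trans (mul_le_mul' hB le_rfl)
  have h2 : B * μ A ^ (1 - 1 / r.toReal) ≠ ⊤ := by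
    refine ENNReal.mul_ne_top hBt (ENNReal.rpow_ne_top_of_nonneg ?_ hμA)
    have : 1 / r.toReal ≤ 1 := by
      rcases eq_or_ne r ⊤ with h | h
      · simp [h]
      · rw [div_le_one (ENNReal.toReal_pos (by positivity) h)]
        have := (ENNReal.toReal_le_toReal ENNReal.one_ne_top h).2 hr
        simpa using this
    linarith
  calc |∫ z, f z ∂μ| ≤ b * (∫⁻ z in A, ‖F z‖ₑ ∂μ).toReal :=
        abs_integral_le_mul_toReal_setLIntegral_ae hF hA hfg hgb hgA (lt_of_le_of_lt h1 h2.lt_top)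
    _ ≤ b * (B * μ A ^ (1 - 1 / r.toReal)).toReal := by gcongr
    _ = b * (B.toReal * (μ A ^ (1 - 1 / r.toReal)).toReal) := by rw [ENNReal.toReal_mul]

set_option maxHeartbeats 3200000 in
/-- **De Rosa–Isett 2024, §5.1, (fin_est_eps_delt), discharged** (symmetric Duchon–Robert form,
flat torus): the printed split `φ = φχ_δ + φ(1-χ_δ)` with the cut-off of Lemma 5.2, the support
condition for `ε < δ`, and the four Hölder bounds on the `4δ`-neighbourhood of `S`. [cite: DeRosaIsett2024, §5.1 (fin_est_eps_delt)] -/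
theorem DeRosaIsett2024_s51_finalBound_holds : DeRosaIsett2024_s51_finalBound := by
  intro d _ _ hd T hT v p hsol hp q hq hq' θ hθ hv D hD S hS hDS γ hγ hdim φ hφ
  haveI : Nonempty d := Fintype.card_pos_iff.1 (by omega)
  set n : ℝ := (Fintype.card d : ℝ) with hn
  set μT := (volume.restrict (Ioo 0 T)).prod (volume : Measure (UnitAddTorus d)) with hμT
  -- integrability classes of the solution
  have hum : AEStronglyMeasurable (uncurry v) μT := aestronglyMeasurable_uncurry_prod hsol.1
  have hpm : AEStronglyMeasurable (uncurry p) μT := aestronglyMeasurable_uncurry_prod hsol.2.2.1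
  have hu3 : ∫⁻ t in Ioo 0 T, ∫⁻ x, ‖v t x‖ₑ ^ (3 : ℕ) < ⊤ :=
    lintegral_pow_three_lt_top_of_memLpBesovSup hq hq' hum hv
  have hq0 : q ≠ 0 := (lt_of_lt_of_le (by norm_num) hq).ne'
  have hq2 : 2 < q := lt_of_lt_of_le (by norm_num) hq
  obtain ⟨hr1, hr0, hrt, hr3⟩ := div_three_facts hq hq'
  have hqq : 0 < q.toReal := ENNReal.toReal_pos hq0 hq'
  have hq3r : 3 ≤ q.toReal := by
    have := (ENNReal.toReal_le_toReal (by norm_num) hq').2 hq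
    simpa using this
  -- the `L^q_t B^θ_q` norm
  set N : ℝ≥0∞ := eLpBesovSupNorm q θ q v volume (Ioo 0 T) with hN
  have hNt : N ≠ ⊤ := hv.2.ne
  -- pressure: Besov regularity and slice integrability
  have huq : ∀ᵐ t ∂(volume.restrict (Ioo 0 T)), MemLp (v t) q volume := hv.1.mono fun t ht => ht.memLp
  obtain ⟨Cq, hCq, hP⟩ := hsol.ae_eBesovSupSeminorm_pressure_le hT hq2 hq' huq
  have hPθ : ∀ᵐ t ∂(volume.restrict (Ioo 0 T)), eBesovSupSeminorm θ (q / 2) (p t) volume ≤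
      Cq * eLpNorm (v t) q volume * eBesovSupSeminorm θ q (v t) volume := hP.mono fun t ht => ht θ
  have hpi : ∀ᵐ t ∂(volume.restrict (Ioo 0 T)),
      Integrable (p t) volume ∧ Integrable (fun y => p t y • v t y) volume := by
    obtain ⟨-, -, Iqv⟩ := integrable_normSq_normCube_norm_mul hum hu3 hpm hp
    have hP32 : ∫⁻ z, ‖p z.1 z.2‖ₑ ^ ((3 / 2 : ℝ≥0∞)).toReal ∂μT < ⊤ := by
      have e : ∫⁻ t in Ioo 0 T, ∫⁻ x, ‖p t x‖ₑ ^ (3 / 2 : ℝ) = ∫⁻ z, ‖p z.1 z.2‖ₑ ^ (3 / 2 : ℝ) ∂μT :=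
        lintegral_Ioo_lintegral_eq_lintegral_prod (hpm.enorm.pow_const _)
      have h32 : ((3 / 2 : ℝ≥0∞)).toReal = (3 / 2 : ℝ) := by
        rw [ENNReal.toReal_div]; norm_num
      rw [h32, ← e]
      exact hp
    have hpslice : ∀ᵐ t ∂(volume.restrict (Ioo 0 T)), MemLp (p t) (3 / 2) volume :=
      ae_memLp_slice_of_lintegral (by norm_num) (ENNReal.div_ne_top (by norm_num) (by norm_num)) hpm hP32
    have hvslice : ∀ᵐ t ∂(volume.restrict (Ioo 0 T)), AEStronglyMeasurable (v t) volume := hum.prodMk_left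
    filter_upwards [hpslice, Iqv.prod_right_ae, hvslice] with t hpt hpv hvt
    have hpI : Integrable (p t) volume := hpt.integrable (by
      rw [ENNReal.le_div_iff_mul_le (Or.inl (by norm_num)) (Or.inl (by norm_num))]; norm_num)
    refine ⟨hpI, ?_⟩
    refine hpv.mono' (hpI.aestronglyMeasurable.smul hvt) (ae_of_all _ fun y => ?_)
    rw [norm_smul]
  -- the constants: cut-off, Minkowski content, test function
  obtain ⟨Ccut, hCcut0, hcut⟩ := Torus.exists_spaceTime_cutoff (d := d)
  obtain ⟨CM, hCM, δ₀, hδ₀, hdimδ⟩ := hdim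
  obtain ⟨hφs, hdt, hgr, -⟩ := hφ.isSpaceTimeTest.isSmoothSpaceTimeOn_derived
  obtain ⟨⟨C0, hC00, hC0⟩, -⟩ := hφs.bound_and_measurable T
  obtain ⟨⟨C1, hC10, hC1⟩, -⟩ := hdt.bound_and_measurable T
  obtain ⟨⟨C2, hC20, hC2⟩, -⟩ := hgr.bound_and_measurable T
  -- exponents
  set e : ℝ := 1 - 1 / (q / 3).toReal with he
  set a : ℝ := (1 - 3 / q).toReal * (n - γ) with ha
  have he' : e = 1 - 3 / q.toReal := by rw [he, hr3]; field_simp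
  have he0 : 0 ≤ e := by
    rw [he']
    have : 3 / q.toReal ≤ 1 := by rw [div_le_one hqq]; exact hq3r
    linarith
  have hae : a = (n - γ) * e := by
    rw [ha, he', ENNReal.toReal_sub_of_le ?_ ENNReal.one_ne_top, ENNReal.toReal_one, ENNReal.toReal_div,
      ENNReal.toReal_ofNat, mul_comm]
    rw [ENNReal.div_le_iff (hq0) (hq'), one_mul]
    exact hq
  have hnγ : 0 ≤ n - γ := by rw [hn]; linarith [hγ.2]
  have ha0 : 0 ≤ a := by rw [hae]; exact mul_nonneg hnγ he0
  -- real constants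
  set NR : ℝ := N.toReal with hNR
  set cM : ℝ := (CM ^ e).toReal * (4 : ℝ) ^ a with hcM
  set C₁ : ℝ := Torus.gradProfileMass d with hC₁
  set KT : ℝ := ((N ^ q.toReal + ENNReal.ofReal T) ^ (1 / (q / 3).toReal)).toReal with hKT
  set CqR : ℝ := Cq.toReal with hCqR
  set b1 : ℝ := C1 + C0 * Ccut + (C2 + C0 * Ccut) with hb1
  set cD : ℝ := C0 * (C₁ * NR ^ 3 * cM) with hcD
  set cT : ℝ := b1 * (KT * cM) with hcT
  set cX : ℝ := b1 * (NR ^ 3 * cM) with hcX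
  set cC : ℝ := b1 * (CqR * NR ^ 3 * cM) with hcC
  set M : ℝ := 2⁻¹ * cD + 2⁻¹ * cT + 2⁻¹ * cX + cC with hM
  have hC₁0 : 0 ≤ C₁ := Torus.gradProfileMass_nonneg (d := d)
  have hNR0 : 0 ≤ NR := ENNReal.toReal_nonneg
  have hcM0 : 0 ≤ cM := mul_nonneg ENNReal.toReal_nonneg (Real.rpow_nonneg (by norm_num) _)
  have hKT0 : 0 ≤ KT := ENNReal.toReal_nonneg
  have hCqR0 : 0 ≤ CqR := ENNReal.toReal_nonneg
  have hb10 : 0 ≤ b1 := by rw [hb1]; positivity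
  have hcD0 : 0 ≤ cD := by rw [hcD]; positivity
  have hcT0 : 0 ≤ cT := by rw [hcT]; positivity
  have hcX0 : 0 ≤ cX := by rw [hcX]; positivity
  have hcC0 : 0 ≤ cC := by rw [hcC]; positivity
  have hM0 : 0 ≤ M := by rw [hM]; positivity
  refine ⟨M, min (δ₀ / 4) (1 / 4), hM0, lt_min (by linarith) (by norm_num), fun ε δ hε hεδ hδ₁ => ?_⟩
  have hδ : 0 < δ := hε.trans hεδ
  have hδ4 : 4 * δ < δ₀ := by have := lt_of_lt_of_le hδ₁ (min_le_left _ _); linarith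
  have hδ1 : δ < 1 := by have := lt_of_lt_of_le hδ₁ (min_le_right _ _); linarith
  have hε' : ε ≤ 1 / 4 := by have := lt_of_lt_of_le hδ₁ (min_le_right _ _); linarith
  set K := Torus.kernel (d := d) ε with hKdef
  have hK : Torus.IsSmooth K := Torus.isSmooth_kernel hε hε'
  have hKi : Integrable K volume := (Torus.continuous_kernel hε hε').integrable_unitAddTorus
  -- the cut-off at scale `δ` and the split `φ = ψ₁ + ψ₂`
  obtain ⟨χ, hχs, hχ01, hχ1, hχ0, hχt, hχx⟩ := hcut S δ hδ
  set ψ₁ : ℝ → UnitAddTorus d → ℝ := fun t x => φ t x * χ t x with hψ₁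
  set ψ₂ : ℝ → UnitAddTorus d → ℝ := fun t x => φ t x * (1 - χ t x) with hψ₂
  have h1χs : ContDiff ℝ ∞ (stLift fun t x => 1 - χ t x) := by
    have e1 : stLift (fun t x => 1 - χ t x) = fun z => 1 - stLift χ z := rfl
    rw [e1]
    exact contDiff_const.sub hχs
  have hψ₁T : IsSpaceTimeTestIoo T ψ₁ := hφ.mul_smooth hχs
  have hψ₂T : IsSpaceTimeTestIoo T ψ₂ := hφ.mul_smooth h1χs
  have hψ₁εT : IsSpaceTimeTestIoo T (fun t => ψ₁ t ⋆ K) := by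
    rw [conv_kernel_comm]; exact isSpaceTimeTestIoo_kernel_conv hψ₁T hKi
  have hψ₂εT : IsSpaceTimeTestIoo T (fun t => ψ₂ t ⋆ K) := by
    rw [conv_kernel_comm]; exact isSpaceTimeTestIoo_kernel_conv hψ₂T hKi
  have hφεT : IsSpaceTimeTestIoo T (fun t => φ t ⋆ K) := by
    rw [conv_kernel_comm]; exact isSpaceTimeTestIoo_kernel_conv hφ hKi
  ---------------------------------------------------------------------------------------------
  -- Step 1: `D φ + D φ_ε = 𝓔 ψ₁ + 𝓔 ψ₁ε`
  ---------------------------------------------------------------------------------------------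
  have hDE : ∀ ψ, IsSpaceTimeTestIoo T ψ → D ψ = energyFluxFunctional T v p ψ :=
    fun ψ hψ => (hD.energyFluxFunctional_eq hψ).symm
  have hψ₂0 : ∀ z ∈ thickening δ S, ψ₂ z.1 z.2 = 0 := fun z hz => by
    simp only [hψ₂, hχ1 z hz, sub_self, mul_zero]
  have hDψ₂ : D ψ₂ = 0 :=
    hDS ψ₂ hψ₂T (disjoint_tsupport_of_eq_zero_on_thickening (f := uncurry ψ₂) hδ fun z hz => hψ₂0 z hz)
  have hDψ₂ε : D (fun t => ψ₂ t ⋆ K) = 0 := by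
    refine hDS _ hψ₂εT (disjoint_tsupport_of_eq_zero_on_thickening
      (f := uncurry fun t => ψ₂ t ⋆ K) (δ := δ - ε) (by linarith) fun z hz => ?_)
    exact conv_kernel_eq_zero_on_thickening hε hψ₂0 z hz
  have hφsplit : φ = fun t x => ψ₁ t x + ψ₂ t x := by
    funext t x; simp only [hψ₁, hψ₂]; ring
  have hc1 : ∀ t, Continuous (ψ₁ t) := fun t => (isSmooth_slice_of_contDiff_stLift hψ₁T.1.1 t).continuous
  have hc2 : ∀ t, Continuous (ψ₂ t) := fun t => (isSmooth_slice_of_contDiff_stLift hψ₂T.1.1 t).continuous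
  have hφεsplit : (fun t => φ t ⋆ K) = fun t x => (ψ₁ t ⋆ K) x + (ψ₂ t ⋆ K) x := by
    funext t
    have e1 : φ t = fun x => ψ₁ t x + ψ₂ t x := by rw [hφsplit]
    rw [e1, conv_kernel_add hc1 hc2 hK.continuous t]
    rfl
  have hsplit : D φ + D (fun t => φ t ⋆ K) =
      energyFluxFunctional T v p ψ₁ + energyFluxFunctional T v p (fun t => ψ₁ t ⋆ K) := by
    have e1 : D φ = energyFluxFunctional T v p ψ₁ + energyFluxFunctional T v p ψ₂ := by
      rw [hDE φ hφ]
      have : energyFluxFunctional T v p φ = energyFluxFunctional T v p (fun t x => ψ₁ t x + ψ₂ t x) := by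
        rw [← hφsplit]
      rw [this]
      exact energyFluxFunctional_add hum hu3 hpm hp hψ₁T.1 hψ₂T.1
    have e2 : D (fun t => φ t ⋆ K) = energyFluxFunctional T v p (fun t => ψ₁ t ⋆ K) +
        energyFluxFunctional T v p (fun t => ψ₂ t ⋆ K) := by
      rw [hDE _ hφεT, hφεsplit]
      exact energyFluxFunctional_add hum hu3 hpm hp hψ₁εT.1 hψ₂εT.1
    have e3 : energyFluxFunctional T v p ψ₂ = 0 := by rw [← hDE ψ₂ hψ₂T]; exact hDψ₂
    have e4 : energyFluxFunctional T v p (fun t => ψ₂ t ⋆ K) = 0 := by rw [← hDE _ hψ₂εT]; exact hDψ₂ε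
    rw [e1, e2, e3, e4, add_zero, add_zero]
  ---------------------------------------------------------------------------------------------
  -- Step 2: the symmetric identity and the four pairings
  ---------------------------------------------------------------------------------------------
  have hid := two_mul_energyFlux_add_energyFlux_mollified_eq hsol hu3 hp hε hε' hψ₁T
  set ID : ℝ := ∫ z, kernelFlux K (v z.1) z.2 * ψ₁ z.1 z.2 ∂μT with hID
  set ωK : ℝ → UnitAddTorus d → ℝ := fun t x => ‖v t x‖ ^ 2 + ((fun y => ‖v t y‖ ^ 2) ⋆ K) x -
    2 * ⟪v t x, vecConv (v t) K x⟫ with hω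
  set CK : ℝ → UnitAddTorus d → EuclideanSpace ℝ d := fun t x => vecConv (fun y => p t y • v t y) K x +
    p t x • v t x - p t x • vecConv (v t) K x - (p t ⋆ K) x • v t x with h𝒞
  set IT : ℝ := ∫ z, ωK z.1 z.2 * Torus.timeDeriv ψ₁ z.1 z.2 ∂μT with hIT
  set IX : ℝ := ∫ z, ωK z.1 z.2 * ⟪v z.1 z.2, Torus.gradient (ψ₁ z.1) z.2⟫ ∂μT with hIX
  set IC : ℝ := ∫ z, ⟪CK z.1 z.2, Torus.gradient (ψ₁ z.1) z.2⟫ ∂μT with hIC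
  have hX : D φ + D (fun t => φ t ⋆ K) = 2⁻¹ * ID + 2⁻¹ * IT + 2⁻¹ * IX + IC := by
    rw [hsplit]
    have h2 : 2 * (energyFluxFunctional T v p ψ₁ + energyFluxFunctional T v p (fun t => ψ₁ t ⋆ K)) =
        ID + IT + IX + 2 * IC := hid
    linear_combination (2⁻¹ : ℝ) * h2
  ---------------------------------------------------------------------------------------------
  -- Step 3: the cut-off test function `ψ₁`: bounds and support
  ---------------------------------------------------------------------------------------------
  set A : Set (ℝ × UnitAddTorus d) := thickening (4 * δ) S with hA
  have hAm : MeasurableSet A := isOpen_thickening.measurableSet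
  have hχball : ∀ z, z ∉ A → ∀ w ∈ ball z δ, χ w.1 w.2 = 0 := by
    intro z hz w hw
    refine hχ0 w fun hw3 => hz ?_
    have h1 : z ∈ ball w δ := by rw [mem_ball, dist_comm]; exact mem_ball.1 hw
    have h2 := ball_subset_thickening_of_mem_thickening (δ := δ) hw3 h1
    rwa [show δ + 3 * δ = 4 * δ by ring] at h2
  have hχA : ∀ z, z ∉ A → χ z.1 z.2 = 0 := fun z hz => hχball z hz z (mem_ball_self hδ)
  have hdtψ₁ : ∀ t x, Torus.timeDeriv ψ₁ t x = Torus.timeDeriv φ t x * χ t x + φ t x * Torus.timeDeriv χ t x :=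
    fun t x => timeDeriv_mul_of_contDiff hφ.1.1 hχs t x
  have hgrψ₁ : ∀ t x, Torus.gradient (ψ₁ t) x = χ t x • Torus.gradient (φ t) x + φ t x • Torus.gradient (χ t) x :=
    fun t x => gradient_mul_of_isSmooth (isSmooth_slice_of_contDiff_stLift hφ.1.1 t) (isSmooth_slice_of_contDiff_stLift hχs t) x
  -- pointwise bounds on `[0,T]`
  have hb1δ : C1 + C0 * (Ccut / δ) ≤ b1 / δ ∧ C2 + C0 * (Ccut / δ) ≤ b1 / δ := by
    constructor
    · rw [le_div_iff₀ hδ, add_mul, mul_assoc, div_mul_cancel₀ _ hδ.ne', hb1]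
      nlinarith [mul_le_of_le_one_right hC10 hδ1.le, mul_nonneg hC00 hCcut0]
    · rw [le_div_iff₀ hδ, add_mul, mul_assoc, div_mul_cancel₀ _ hδ.ne', hb1]
      nlinarith [mul_le_of_le_one_right hC20 hδ1.le, mul_nonneg hC00 hCcut0]
  have hψ₁b : ∀ t ∈ Icc 0 T, ∀ x, |ψ₁ t x| ≤ C0 := by
    intro t ht x
    simp only [hψ₁, abs_mul]
    calc |φ t x| * |χ t x| ≤ C0 * 1 := by
          gcongr
          · exact (Real.norm_eq_abs _).symm.le.trans (hC0 t ht x)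
          · rw [abs_of_nonneg (hχ01 t x).1]; exact (hχ01 t x).2
      _ = C0 := mul_one _
  have hdtψ₁b : ∀ t ∈ Icc 0 T, ∀ x, |Torus.timeDeriv ψ₁ t x| ≤ b1 / δ := by
    intro t ht x
    rw [hdtψ₁]
    calc |Torus.timeDeriv φ t x * χ t x + φ t x * Torus.timeDeriv χ t x|
        ≤ |Torus.timeDeriv φ t x| * |χ t x| + |φ t x| * |Torus.timeDeriv χ t x| := by
          refine (abs_add_le _ _).trans ?_; rw [abs_mul, abs_mul]
      _ ≤ C1 * 1 + C0 * (Ccut / δ) := by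
          gcongr
          · exact (Real.norm_eq_abs _).symm.le.trans (hC1 t ht x)
          · rw [abs_of_nonneg (hχ01 t x).1]; exact (hχ01 t x).2
          · exact (Real.norm_eq_abs _).symm.le.trans (hC0 t ht x)
          · exact hχt t x
      _ ≤ b1 / δ := by rw [mul_one]; exact hb1δ.1
  have hgrψ₁b : ∀ t ∈ Icc 0 T, ∀ x, ‖Torus.gradient (ψ₁ t) x‖ ≤ b1 / δ := by
    intro t ht x
    rw [hgrψ₁]
    calc ‖χ t x • Torus.gradient (φ t) x + φ t x • Torus.gradient (χ t) x‖
        ≤ |χ t x| * ‖Torus.gradient (φ t) x‖ + |φ t x| * ‖Torus.gradient (χ t) x‖ := by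
          refine (norm_add_le _ _).trans ?_; rw [norm_smul, norm_smul, Real.norm_eq_abs, Real.norm_eq_abs]
      _ ≤ 1 * C2 + C0 * (Ccut / δ) := by
          gcongr
          · rw [abs_of_nonneg (hχ01 t x).1]; exact (hχ01 t x).2
          · exact hC2 t ht x
          · exact (Real.norm_eq_abs _).symm.le.trans (hC0 t ht x)
          · exact hχx t x
      _ ≤ b1 / δ := by rw [one_mul]; exact hb1δ.2
  -- vanishing off `A`
  have hψ₁A : ∀ z, z ∉ A → ψ₁ z.1 z.2 = 0 := fun z hz => by simp only [hψ₁, hχA z hz, mul_zero]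
  have hdtψ₁A : ∀ z, z ∉ A → Torus.timeDeriv ψ₁ z.1 z.2 = 0 := fun z hz => by
    rw [hdtψ₁, hχA z hz, timeDeriv_eq_zero_of_ball hδ (hχball z hz), mul_zero, mul_zero, add_zero]
  have hgrψ₁A : ∀ z, z ∉ A → Torus.gradient (ψ₁ z.1) z.2 = 0 := fun z hz => by
    rw [hgrψ₁, hχA z hz, gradient_eq_zero_of_ball hδ (hχball z hz), zero_smul, smul_zero, add_zero]
  -- a.e. time in `(0,T)`
  have hIoo : ∀ᵐ z ∂μT, z.1 ∈ Ioo 0 T := ae_fst_mem_Ioo T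
  ---------------------------------------------------------------------------------------------
  -- Step 4: the measure of `A` and the exponent algebra
  ---------------------------------------------------------------------------------------------
  have hμA : μT A ≤ CM * ENNReal.ofReal ((4 * δ) ^ (n - γ)) := by
    have h1 : μT A ≤ volume A := by
      rw [hμT, ← volume_restrict_Ioo_prod_univ]
      exact Measure.le_iff'.1 Measure.restrict_le_self A
    exact h1.trans (hdimδ (4 * δ) ⟨by linarith, hδ4⟩)
  have hμAt : μT A ≠ ⊤ :=
    (lt_of_le_of_lt hμA (ENNReal.mul_lt_top hCM.lt_top ENNReal.ofReal_lt_top)).ne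
  have hAe : (μT A ^ (1 - 1 / (q / 3).toReal)).toReal ≤ cM * δ ^ a := by
    rw [← he]
    have h1 : μT A ^ e ≤ (CM * ENNReal.ofReal ((4 * δ) ^ (n - γ))) ^ e := ENNReal.rpow_le_rpow hμA he0
    have h2 : ((CM * ENNReal.ofReal ((4 * δ) ^ (n - γ))) ^ e).toReal = cM * δ ^ a := by
      rw [ENNReal.mul_rpow_of_nonneg _ _ he0, ENNReal.toReal_mul,
        ENNReal.ofReal_rpow_of_nonneg (Real.rpow_nonneg (by linarith) _) he0,
        ENNReal.toReal_ofReal (Real.rpow_nonneg (Real.rpow_nonneg (by linarith) _) _),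
        ← Real.rpow_mul (by linarith), ← hae, Real.mul_rpow (by norm_num) hδ.le, hcM, mul_assoc]
    rw [← h2]
    exact ENNReal.toReal_mono
      (ENNReal.rpow_ne_top_of_nonneg he0 (ENNReal.mul_ne_top hCM ENNReal.ofReal_ne_top)) h1
  -- powers of `ε` and `δ`
  have hε3 : ε⁻¹ * (ε ^ θ) ^ 3 = ε ^ (3 * θ - 1) := by
    rw [show ((ε ^ θ) ^ 3 : ℝ) = ε ^ (3 * θ) by
      rw [← Real.rpow_natCast, ← Real.rpow_mul hε.le]; ring_nf,
      Real.rpow_sub_one hε.ne', div_eq_inv_mul]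
  have hε2 : ((ε ^ θ) ^ 2 : ℝ) = ε ^ (2 * θ) := by
    rw [← Real.rpow_natCast, ← Real.rpow_mul hε.le]; ring_nf
  have hδa : δ ^ a / δ = δ ^ (a - 1) := (Real.rpow_sub_one hδ.ne' a).symm
  have hE3 : 0 ≤ ε ^ (3 * θ - 1) := Real.rpow_nonneg hε.le _
  have hE2 : 0 ≤ ε ^ (2 * θ) := Real.rpow_nonneg hε.le _
  have hDa : 0 ≤ δ ^ a := Real.rpow_nonneg hδ.le _
  have hDa1 : 0 ≤ δ ^ (a - 1) := Real.rpow_nonneg hδ.le _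
  -- `toReal` of the `ℝ≥0∞` constants
  have htoD : (ENNReal.ofReal (ε⁻¹ * C₁) * ENNReal.ofReal (ε ^ θ) ^ 3 * N ^ (3 : ℕ)).toReal =
      ε⁻¹ * C₁ * (ε ^ θ) ^ 3 * NR ^ 3 := by
    rw [ENNReal.toReal_mul, ENNReal.toReal_mul, ENNReal.toReal_pow, ENNReal.toReal_pow,
      ENNReal.toReal_ofReal (by positivity), ENNReal.toReal_ofReal (by positivity)]
  have htoT : (ENNReal.ofReal (ε ^ θ) ^ 2 * (N ^ q.toReal + ENNReal.ofReal T) ^ (1 / (q / 3).toReal)).toReal =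
      (ε ^ θ) ^ 2 * KT := by
    rw [ENNReal.toReal_mul, ENNReal.toReal_pow, ENNReal.toReal_ofReal (by positivity)]
  have htoX : (ENNReal.ofReal (ε ^ θ) ^ 2 * N ^ (3 : ℕ)).toReal = (ε ^ θ) ^ 2 * NR ^ 3 := by
    rw [ENNReal.toReal_mul, ENNReal.toReal_pow, ENNReal.toReal_pow, ENNReal.toReal_ofReal (by positivity)]
  have htoC : (Cq * ENNReal.ofReal (ε ^ θ) ^ 2 * N ^ (3 : ℕ)).toReal = CqR * (ε ^ θ) ^ 2 * NR ^ 3 := by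
    rw [ENNReal.toReal_mul, ENNReal.toReal_mul, ENNReal.toReal_pow, ENNReal.toReal_pow,
      ENNReal.toReal_ofReal (by positivity)]
  have hfinT : (N ^ q.toReal + ENNReal.ofReal T) ^ (1 / (q / 3).toReal) ≠ ⊤ :=
    ENNReal.rpow_ne_top_of_nonneg (by positivity)
      (ENNReal.add_ne_top.2 ⟨ENNReal.rpow_ne_top_of_nonneg hqq.le hNt, ENNReal.ofReal_ne_top⟩)
  have hN3t : N ^ (3 : ℕ) ≠ ⊤ := ENNReal.pow_ne_top hNt
  ---------------------------------------------------------------------------------------------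
  -- Step 5: the four bounds
  ---------------------------------------------------------------------------------------------
  -- measurability of the three fields
  have hDm : AEStronglyMeasurable (uncurry fun t x => kernelFlux K (v t) x) μT := by
    have hδ' : AEStronglyMeasurable (fun w : (ℝ × UnitAddTorus d) × UnitAddTorus d =>
        v w.1.1 (w.1.2 + w.2) - v w.1.1 w.1.2) (μT.prod volume) :=
      (aestronglyMeasurable_translate (ν := volume) hum measurable_id).sub hum.comp_fst
    have hΨ : AEStronglyMeasurable (fun w : (ℝ × UnitAddTorus d) × UnitAddTorus d =>
        ⟪Torus.gradient K w.2, v w.1.1 (w.1.2 + w.2) - v w.1.1 w.1.2⟫ *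
          ‖v w.1.1 (w.1.2 + w.2) - v w.1.1 w.1.2‖ ^ 2) (μT.prod volume) :=
      ((hK.gradient.continuous.aestronglyMeasurable.comp_snd).inner hδ').mul (hδ'.norm.pow 2)
    exact hΨ.integral_prod_right'
  have hωm : AEStronglyMeasurable (uncurry ωK) μT := aestronglyMeasurable_uncurry_quadIncrement hK.continuous hum
  have h𝒞m : AEStronglyMeasurable (uncurry CK) μT :=
    aestronglyMeasurable_uncurry_pressureRemainder hK.continuous hum hpm
  have hωvm : AEStronglyMeasurable (uncurry fun t x => ωK t x * ‖v t x‖) μT := hωm.mul hum.norm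
  -- (D) the flux term
  have hTD : |ID| ≤ cD * (ε ^ (3 * θ - 1) * δ ^ a) := by
    have hB := eLpNorm_uncurry_kernelFlux_le (ε := ε) hum hq hq' hθ.1 hv hε hε'
    have h := abs_integral_le_of_eLpNorm_le (μ := μT) (f := fun z => kernelFlux K (v z.1) z.2 * ψ₁ z.1 z.2)
      (F := uncurry fun t x => kernelFlux K (v t) x) (g := fun z => |ψ₁ z.1 z.2|) hDm hAm hC00
      (ae_of_all _ fun z => by simp only [uncurry, Real.norm_eq_abs, abs_mul]; rfl)
      (hIoo.mono fun z hz _ => hψ₁b z.1 (Ioo_subset_Icc_self hz) z.2)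
      (fun z hz => by simp only [hψ₁A z hz, abs_zero]) hr1 hB
      (ENNReal.mul_ne_top (ENNReal.mul_ne_top ENNReal.ofReal_ne_top (ENNReal.pow_ne_top ENNReal.ofReal_ne_top)) hN3t)
      hμAt
    rw [htoD] at h
    refine h.trans ?_
    calc C0 * (ε⁻¹ * C₁ * (ε ^ θ) ^ 3 * NR ^ 3 * (μT A ^ (1 - 1 / (q / 3).toReal)).toReal)
        ≤ C0 * (ε⁻¹ * C₁ * (ε ^ θ) ^ 3 * NR ^ 3 * (cM * δ ^ a)) := by gcongr
      _ = cD * (ε⁻¹ * (ε ^ θ) ^ 3 * δ ^ a) := by rw [hcD]; ring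
      _ = cD * (ε ^ (3 * θ - 1) * δ ^ a) := by rw [hε3]
  -- (T) the quadratic commutator against `∂ₜψ₁`
  have hTT : |IT| ≤ cT * (ε ^ (2 * θ) * δ ^ (a - 1)) := by
    have hB := eLpNorm_uncurry_quadIncrement_le (ε := ε) hum hq hq' hθ.1 hv hε hε'
    have h := abs_integral_le_of_eLpNorm_le (μ := μT) (f := fun z => ωK z.1 z.2 * Torus.timeDeriv ψ₁ z.1 z.2)
      (F := uncurry ωK) (g := fun z => |Torus.timeDeriv ψ₁ z.1 z.2|) hωm hAm (div_nonneg hb10 hδ.le)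
      (ae_of_all _ fun z => by simp only [uncurry, Real.norm_eq_abs, abs_mul]; rfl)
      (hIoo.mono fun z hz _ => hdtψ₁b z.1 (Ioo_subset_Icc_self hz) z.2)
      (fun z hz => by simp only [hdtψ₁A z hz, abs_zero]) hr1 hB
      (ENNReal.mul_ne_top (ENNReal.pow_ne_top ENNReal.ofReal_ne_top) hfinT) hμAt
    rw [htoT] at h
    refine h.trans ?_
    calc b1 / δ * ((ε ^ θ) ^ 2 * KT * (μT A ^ (1 - 1 / (q / 3).toReal)).toReal)
        ≤ b1 / δ * ((ε ^ θ) ^ 2 * KT * (cM * δ ^ a)) := by gcongr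
      _ = cT * ((ε ^ θ) ^ 2 * (δ ^ a / δ)) := by rw [hcT]; ring
      _ = cT * (ε ^ (2 * θ) * δ ^ (a - 1)) := by rw [hε2, hδa]
  -- (X) the quadratic commutator against `⟪v, ∇ψ₁⟫`
  have hTX : |IX| ≤ cX * (ε ^ (2 * θ) * δ ^ (a - 1)) := by
    have hB := eLpNorm_uncurry_quadIncrement_mul_norm_le (ε := ε) hum hq hq' hθ.1 hv hε hε'
    have h := abs_integral_le_of_eLpNorm_le (μ := μT)
      (f := fun z => ωK z.1 z.2 * ⟪v z.1 z.2, Torus.gradient (ψ₁ z.1) z.2⟫)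
      (F := uncurry fun t x => ωK t x * ‖v t x‖) (g := fun z => ‖Torus.gradient (ψ₁ z.1) z.2‖) hωvm hAm
      (div_nonneg hb10 hδ.le)
      (ae_of_all _ fun z => by
        simp only [uncurry, Real.norm_eq_abs, abs_mul, abs_norm]
        rw [mul_assoc]
        gcongr
        exact abs_real_inner_le_norm _ _)
      (hIoo.mono fun z hz _ => hgrψ₁b z.1 (Ioo_subset_Icc_self hz) z.2)
      (fun z hz => by simp only [hgrψ₁A z hz, norm_zero]) hr1 hB
      (ENNReal.mul_ne_top (ENNReal.pow_ne_top ENNReal.ofReal_ne_top) hN3t) hμAt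
    rw [htoX] at h
    refine h.trans ?_
    calc b1 / δ * ((ε ^ θ) ^ 2 * NR ^ 3 * (μT A ^ (1 - 1 / (q / 3).toReal)).toReal)
        ≤ b1 / δ * ((ε ^ θ) ^ 2 * NR ^ 3 * (cM * δ ^ a)) := by gcongr
      _ = cX * ((ε ^ θ) ^ 2 * (δ ^ a / δ)) := by rw [hcX]; ring
      _ = cX * (ε ^ (2 * θ) * δ ^ (a - 1)) := by rw [hε2, hδa]
  -- (C) the pressure commutator
  have hTC : |IC| ≤ cC * (ε ^ (2 * θ) * δ ^ (a - 1)) := by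
    have hB := eLpNorm_uncurry_pressureRemainder_le (ε := ε) hum hpm hq hq' hθ.1 hv hpi hCq hPθ hε hε'
    have h := abs_integral_le_of_eLpNorm_le (μ := μT)
      (f := fun z => ⟪CK z.1 z.2, Torus.gradient (ψ₁ z.1) z.2⟫)
      (F := uncurry CK) (g := fun z => ‖Torus.gradient (ψ₁ z.1) z.2‖) h𝒞m hAm (div_nonneg hb10 hδ.le)
      (ae_of_all _ fun z => by
        simp only [uncurry, Real.norm_eq_abs]
        exact abs_real_inner_le_norm _ _)
      (hIoo.mono fun z hz _ => hgrψ₁b z.1 (Ioo_subset_Icc_self hz) z.2)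
      (fun z hz => by simp only [hgrψ₁A z hz, norm_zero]) hr1 hB
      (ENNReal.mul_ne_top (ENNReal.mul_ne_top hCq (ENNReal.pow_ne_top ENNReal.ofReal_ne_top)) hN3t) hμAt
    rw [htoC] at h
    refine h.trans ?_
    calc b1 / δ * (CqR * (ε ^ θ) ^ 2 * NR ^ 3 * (μT A ^ (1 - 1 / (q / 3).toReal)).toReal)
        ≤ b1 / δ * (CqR * (ε ^ θ) ^ 2 * NR ^ 3 * (cM * δ ^ a)) := by gcongr
      _ = cC * ((ε ^ θ) ^ 2 * (δ ^ a / δ)) := by rw [hcC]; ring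
      _ = cC * (ε ^ (2 * θ) * δ ^ (a - 1)) := by rw [hε2, hδa]
  ---------------------------------------------------------------------------------------------
  -- Step 6: conclusion
  ---------------------------------------------------------------------------------------------
  rw [hX]
  set P : ℝ := ε ^ (3 * θ - 1) * δ ^ a with hPdef
  set Q : ℝ := ε ^ (2 * θ) * δ ^ (a - 1) with hQdef
  have hP0 : 0 ≤ P := mul_nonneg hE3 hDa
  have hQ0 : 0 ≤ Q := mul_nonneg hE2 hDa1
  have habs : |2⁻¹ * ID + 2⁻¹ * IT + 2⁻¹ * IX + IC| ≤ 2⁻¹ * |ID| + 2⁻¹ * |IT| + 2⁻¹ * |IX| + |IC| := by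
    have h2 : (0 : ℝ) ≤ 2⁻¹ := by norm_num
    calc |2⁻¹ * ID + 2⁻¹ * IT + 2⁻¹ * IX + IC|
        ≤ |2⁻¹ * ID| + |2⁻¹ * IT| + |2⁻¹ * IX| + |IC| := by
          refine (abs_add_le _ _).trans ?_
          gcongr
          refine (abs_add_le _ _).trans ?_
          gcongr
          exact abs_add_le _ _
      _ = 2⁻¹ * |ID| + 2⁻¹ * |IT| + 2⁻¹ * |IX| + |IC| := by
          rw [abs_mul, abs_mul, abs_mul, abs_of_nonneg h2]
  have h1 : 2⁻¹ * cD * P ≤ M * P := mul_le_mul_of_nonneg_right (by rw [hM]; linarith) hP0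
  have h2 : (2⁻¹ * cT + 2⁻¹ * cX + cC) * Q ≤ M * Q := mul_le_mul_of_nonneg_right (by rw [hM]; linarith) hQ0
  calc |2⁻¹ * ID + 2⁻¹ * IT + 2⁻¹ * IX + IC| ≤ 2⁻¹ * |ID| + 2⁻¹ * |IT| + 2⁻¹ * |IX| + |IC| := habs
    _ ≤ 2⁻¹ * (cD * P) + 2⁻¹ * (cT * Q) + 2⁻¹ * (cX * Q) + cC * Q := by gcongr
    _ = 2⁻¹ * cD * P + (2⁻¹ * cT + 2⁻¹ * cX + cC) * Q := by ring
    _ ≤ M * P + M * Q := add_le_add h1 h2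
    _ = M * (P + Q) := by ring

/-! ## Theorems 2.7 and 2.13 -/

/-- **De Rosa–Isett 2024, Theorem 2.7 (Eulerian intermittency), discharged** from the tree's
reduction `DeRosaIsett2024_thm27_of_s51` and the two §5.1 steps. [cite: DeRosaIsett2024, Theorem 2.7] -/
theorem DeRosaIsett2024_thm27_holds : DeRosaIsett2024_thm27 :=
  DeRosaIsett2024_thm27_of_s51 DeRosaIsett2024_s51_finalBound_holds DeRosaIsett2024_s51_mollifiedLimit_holds

/-- **De Rosa–Isett 2024, Theorem 2.13 (intermittency from lower-dimensional dissipation in the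
inviscid limit), discharged** from Theorem 2.7 and the compactness step of §6.1
(`DeRosaIsett2024_thm213_of_thm27_of_compactness`, `DeRosaIsett2024_s61_compactness_holds`). [cite: DeRosaIsett2024, Theorem 2.13] -/
theorem DeRosaIsett2024_thm213_holds : DeRosaIsett2024_thm213 :=
  DeRosaIsett2024_thm213_of_thm27_of_compactness DeRosaIsett2024_thm27_holds
    DeRosaIsett2024_s61_compactness_holds

end Literature.Barriers.AnomalousDissipation

end
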